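import Literature.MathematicalPhysics.QuantumFieldTheory.Balaban1983to89.B16Sect1DisplaysPrinted
import Literature.MathematicalPhysics.QuantumFieldTheory.Balaban1983to89.B16LargeFieldFactors380
import Literature.MathematicalPhysics.QuantumFieldTheory.Balaban1983to89.B16Sect1Kernels

/-!
# `Balaban1983to89.B16StepFactorsPrinted` — [Balaban1989LargeFieldII] §1 pp. 380–383: the PER-STEP large-field factor
sentences that precede the summary (1.79), BUNDLED BY NAME for one run at one step, as ONE printed claim (typed skeleton; the
per-step analogue of `…B16Sect1DisplaysPrinted` = milestone (A1b) of the cell's NE7b memo `g62/A1-PRINT-READ.md` §3; «J3-lit»;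
INTERFACE REQUEST NE7b IR-100-2 of the row OWNER `t4-ne7b-p1` gen 100 — ruling W-ne7bp1-g100-1, pub-balaban journal l.47623
[NE7bP1-G100-RULING1] «AGREE (a) … statement list ACCEPTED AS STAGED», located words (w-i)–(w-iii) folded as written; the
refuter's located objection π-J3lit-1 «STEP INDEX ∕ THRESHOLD LEVEL ∕ RANGE» (journal l.47732) in its repair form (α′) as RULED
by the owner (W-ne7bp1-g100-3, l.47754: each factor kind at print's level FOR THE OPERATION — below, INDEX CONVENTION; D-J4-1
decided = (α′)); asked by the gaps seat ne6 gen 3, INTENT I-gapsne6-g3-1 l.47443; typist = gaps seat ne6; author-lineage first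
refusal lit-balaban r13; X-read chair leaf-01 (X-IR1002 PASS on v3.1, l.47734; note N-1 folded))

statement-level skeleton of published theorems with citation tags; proofs where landed; nothing here is a claim about
the Yang–Mills mass gap

HONEST FRAMING.  A `def … : Prop` over ABSTRACT one-step carriers supplied as DATA (`StepCarriers`), in the style of the
siblings `B16Sect1DisplaysPrinted.Sect1DisplaysPrinted`, `B16.Thm1Printed`: the printed prose of pp. 380–383 — which walks
through ONE renormalization step j of the k-fold integral (1.71) and states, characteristic function by characteristic
function, the factor each *"yields"* — read as ONE hypothesis shape per step: the unit weight of the step's large-field choice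
is at most (group-valued integrals) × (A_j-integral) × (the constant the step's large-field domain Z_j contributes, p. 380
l. 12–18, in its FIRST printed form `exp O(1) log g_j⁻²|Z_j|`) × Π_i (the fundamental large-field factor of the component
Z_j^{(i)}, p. 381, SHARP `min{…}` form) × Π′ (the preparatory factors, p. 383, SHARP form `exp(−R_j^{−d−5}p₁²(g_j))`).  Rounded by
the siblings' arithmetic this is EXACTLY the level-j factor of the hypothesis `hfac` of the sibling's PROVED corollary
`B16Ineq179.ineq179_of_factors` ((1.79) ⇐ per-history products of per-step factors + p. 383 l. 21–28), one level finer than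
(1.79) itself (§3 `stepFactor179_le`); kept in the first form, the volume constant is also the per-site reading the cell's
END record pins (`HistReadDataLWL.hΛL`: `log Λ = cΛ·(M·R_t)^d·ℓ_t`, [B16] p. 380 l. 15–18 as LOCATOR); print states it in prose and two displays (p. 381 top, p. 383 after (1.78)), the cell's independent
print-read `pub-balaban-gaps/ne/NE7b-A3-READ.md` e0c17235ec591bb7 found the per-step ∕ per-term form INSPECTION-SHAPED (print
DERIVES (1.79) per admissible sequence from these per-step factors; 0 obstruction, 5 located caveats).  Nothing is restated
(the arithmetic of pp. 380–381 and of the p. 383 proviso is the siblings' `B16LargeFieldFactors380.display381` ∕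
`fundamentalFactor_le` and `B16Sect1Kernels.exp_lfFactor_le_exp_neg_p0`, cited BY NAME in §3), nothing of Bałaban's is asserted,
no proof of the analytic content is claimed (the manuscript is UNDER AUDIT: 0∕13 main theorems of the series are proved in the
tree; that the characteristic functions DO yield the factors is Theorem 1 [15] + (71) [16] + the positivity bound (1.7) — rows
B11.Thm1, B10.Eq71, B16.Eq1.7 of `lit-balaban-r13/ROWS-B16.md`, the «NOT HERE» list of `B16LargeFieldFactors380`).  VACUOUS IN
ISOLATION (memo g62 §3, as for (A1b)): with carriers chosen freely every conjunct is inhabited by trivial data (§4); the bundle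
earns its keep only when `Choice`∕`T1` are the one-step maps of Bałaban's (1.71) — the cell's (A1c) ∕ J3 «which tower is
Bałaban's» — at which point the (A3) junction's ONE remaining display `hw : op_j(g,p) 1 ≤ wStep fB fR Λ K j g p` (IR-99-3
`B16HistoryReprReadCausal.histRead_tower_of_hw`; in pinned shape `HwPinned`, IR-100-1 (A) `B16HistoryStepDisplayPinned`) cites
`StepFactorsPrinted` BY NAME for its printed half; the SHARP forms (F)∕(P) below are the valuations IR-100-1 (B)
`B16HistoryStepDisplayValuations.sB380` (= (F)'s exponent letter for letter over the same `minConst`) and a future `sRprep` read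
(owner word (w-i)).  Rung (B)+1 context
only: NOT the continuum limit, NOT infinite volume, NOT a mass gap, NOT Clay.  BY-NAME EFFECT ON THE ROW's WALL: NONE until
J3 consumes it; NE7b NOT PRINTED ∕ NOT PROVED; spine 0∕9.

Printed context (verbatim; renders `b2b-balaban-ref1/pages/1989-cmp122-large-field-II/…-p026∕p027∕p028∕p029-x2.png` READ AS
IMAGES by this seat 2026-08-22; journal page = render + 354).  p. 380 l. 8–18: *"From the inequality (1.73) it is clear that
we have to find a bound of 𝐓′_k(X,(U,0))1, which we denote for simplicity by 𝐓′_k(X)1. At first we bound all the expressions in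
the exponential, except the Wilson action and the quadratic forms. … In effect we get a bound, to which every large field
domain Z_j contributes the constant O(1) log g_j⁻²|Z_j| ≦ O(1) log g_j⁻²(MR_j)^d d′_j(Z_j) ≦ O(1)M^dR_j^{d+1}d′_j(Z_j), where
d′_j is the linear size defined in terms of MR_j-cubes instead of M-cubes. Next, we bound the Wilson action and the quadratic
forms, or rather the corresponding Gaussian integrals. We have to obtain all small factors connected with large fields. …
Consider large field characteristic functions introduced in the j^{th} step. There is the function χᶜ_j(P_j), which yields the
factor exp(−γ₀(1∕(2g_j²))(B₃⁻¹ε_j)²(LM₂R_j)^{−d}|P_j|) … The function χ′ᶜ_j(Q_j) yields the factor … The characteristic function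
χ^{(j−1)c}(R_j) yields the factor … Take the cover of the large field region P_j∪Q_j∪R_j by MR_j-cubes … This domain is a
union of components denoted by Z_j^{(i)}"*; p. 381 top: *"For each component the above large field factors yield an
exponential factor, which can be estimated by exp(−γ₀ min{½B₃⁻²A₀², 2A₁², A₁²}p₀²(g_j)(d′_j(Z_j^{(i)}) + 1)) ≦
exp(−½γ₀A₁²p₀²(g_j)(d′_j(Z_j^{(i)}) + 1) − 2p₀(g_j)). These are the fundamental large field factors, which control
convergence of the expansion of the effective densities."*; p. 381 ¶ 3: *"Besides the above large field factors there are
also the factors arising in the preparatory steps to the 𝐑-operation … These factors are connected with components of a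
large field region Z_j, which satisfies the conditions (i), (ii) … Thus, if one of the functions 1 − χ_j^{(n)} is introduced
in such a component, we get a factor …"* (pp. 381–383: each such factor displayed and bounded); p. 383 after (1.78): *"… yield
the following large field factor: exp(−½γ₀[6(d + 3)(100M(L + 1)N^{β₀}R_j)^{d+2}]⁻¹A₁²p₁(g_j)) < exp(−R_j^{−d−5}p₁²(g_j)). This
is the largest factor among all the small factors we have obtained from the large field characteristic functions in the
preparatory steps. We assume that 2p₁ − (d + 5)r₀ > p₀, and we estimate the factors by exp(−p₀(g_j))."*; p. 383 l. 21–24: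
*"All the integrals with respect to the group valued variables in the definition (1.71) are estimated by 1. … The integrals
with respect to the fields A_j in (2.21) [III], or (1.25) [IV], are estimated using the positivity properties of the
quadratic forms, and we get the factors exp O(1)|Z_j ∩ Ω_j|, where the volume is for the corresponding scale."*; then
*"Let us summarize now the results of the above estimates. We have obtained the following inequality: (1.79)"*.
[Balaban1989LargeFieldII, pp. 380-383 (the sentences before (1.79))]

What is here: §1 `StepCarriers D j` (DATA: the carriers of ONE step's factor sentences) and `Consts` (letters, incl. the
profiles `R(g)`, `p₁(g)`); §2 `StepDisplaysAt D j X c` (the conjunction at one step, each conjunct a quoted sentence) and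
`StepFactorsPrinted C X c` (pattern `B16.Thm1Printed`: ∃ γ > 0, ∀ runs with `InInterval γ`, ∀ operations j < K; births∕volume at
`g_{j+1}`, renewals at `g_j` — INDEX CONVENTION below); §3 bookkeeping:
projections by `And`-elimination, ONE PROVED junction `stepFactor179_le` — the step's sentences, with p. 380's chain read for
`dZ` and rounded by the siblings' `display381` and the p. 383 proviso, give EXACTLY the level-j factor of `ineq179_of_factors`'s
`hfac` (real arithmetic; nothing of Bałaban's asserted) — and `birthRoom381`∕`_nonneg`: the PROVED exponent room of p. 381's
sharp LEFT member over its face-value RIGHT member (the row owner's Q-J3-2); §4 sanity (shape non-vacuity).  Deliberately NOT here: any operation of (1.71), any measure,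
the tower ∕ step reading of the cell's (α)-instance (Summits side), M5's credit reading, any estimate.
-/

namespace Literature.MathematicalPhysics.QuantumFieldTheory.Balaban1983to89.B16StepFactorsPrinted

open Literature.MathematicalPhysics.QuantumFieldTheory.Balaban1983to89
open B16LargeFieldFactors380

noncomputable section

/-! ## §1 The one-step carriers (DATA) and the letters -/

/-- **THE CARRIERS OF THE PER-STEP FACTOR SENTENCES FOR ONE RUN AT ONE STEP `j`** (data, no claim): the type `Choice` of the
step's large-field choices (one summand of (1.71)'s «Σ_{{Ω^c_j∩X, Z_j∩X}, r}» AT STEP j, after any earlier history: the regions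
P_j, Q_j, R_j and the preparatory functions introduced — p. 380 «Consider large field characteristic functions introduced in
the j^{th} step»), the type `V` of the variables the step's unit weight still depends on, and per choice `p`: `T1 p v` = the
unit weight of the step restricted to the choice (the step-j factor of 𝐓′_k(X)1, p. 380 l. 8–9); `comps p` = the components
Z_j^{(i)} of the MR_j-cube cover of P_j ∪ Q_j ∪ R_j with their linear sizes `dC p i = d′_j(Z_j^{(i)})` and the factor `bfac p i`
the three characteristic functions yield on the component (p. 380 bottom – p. 381 top); `primed p` = the components of Z_j
satisfying (i), (ii) in which a preparatory large-field function is introduced, with the factor `lfPrep p i` it yields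
(pp. 381–383); `vfac p` = the constant the large-field domain Z_j contributes (p. 380 l. 12–18: vacuum-energy counterterms and
normalization constants), `volZ p = |Z_j|` (sites of the scale), `dZ p = d′_j(Z_j)` (in the cell's repaired `+1` reading a
consumer instantiates `dZ p = d′_j(Z_j) + 1`, transcript note D-b02.7, as for `B16Ineq179.ineq179_of_factors`); `gInt p`, `aInt p`,
`volZΩ p = |Z_j ∩ Ω_j|` of p. 383 l. 21–24.  INDEX: print's «j-th step» PRODUCES level j; the structure's index `j` is the
cell's tower step `op j` (level `j → j+1`), so for it the created regions `comps`∕`vfac`∕`volZ`∕`dZ` are print's level-(j+1)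
objects and the `primed` components are level-j objects (INDEX CONVENTION of `StepFactorsPrinted`; §2 reads the thresholds so).
`comps` and `primed` are typed INDEPENDENTLY, as in `B16Ineq179.Ineq179` (neither a subfamily of the other).  TOTALITY NOTE (as for the sibling's
`StepCarriers`): total functions on abstract types; print is silent off the choices that occur, where §2's shape is
junk-satisfiable, so totality forces no vacuity and makes no claim.  DATA read off print's sentences; nothing claimed.
[cite: Balaban1989LargeFieldII, pp.380-383 (the objects named before (1.79))] -/
structure StepCarriers (D : B16.RunData) (j : ℕ) where
  /-- the step's large-field choices, the remaining variables, the component labels -/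
  (Choice V ι : Type)
  /-- the unit weight of the step restricted to a choice, as a function of the remaining variables -/
  T1 : Choice → V → ℝ
  /-- the components `Z_j^{(i)}` of the MR_j-cube cover of `P_j ∪ Q_j ∪ R_j`; the primed components -/
  (comps primed : Choice → Finset ι)
  /-- `d′_j(Z_j^{(i)})`, the linear size of a component in MR_j-cubes -/
  dC : Choice → ι → ℝ
  /-- the factor the three characteristic functions of step j yield on the component `Z_j^{(i)}` -/
  bfac : Choice → ι → ℝ
  /-- the preparatory large-field factor attached to a primed component -/
  lfPrep : Choice → ι → ℝ
  /-- p. 380 l. 12–18: the constant the large-field domain `Z_j` contributes; `|Z_j|`; `d′_j(Z_j)` -/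
  (vfac volZ dZ : Choice → ℝ)
  /-- p. 383 l. 21–24: the group-valued integrals, the A_j-integral, the volume `|Z_j ∩ Ω_j|` of the choice -/
  (gInt aInt volZΩ : Choice → ℝ)

/-- **THE LETTERS OF pp. 380–383** (chosen before γ and before the run; print's «O(1)», «absolute positive constant»):
`C380` the O(1) of p. 380 l. 12–18 in its FIRST form «O(1) log g_j⁻²|Z_j|» (per site; owner Q-62-fit-1: «cΛ := O(1)_{p.380} +
O(1)_{A_j}»; print's chain turns it into the O(1)M^dR_j^{d+1}d′_j(Z_j) of (1.79)'s first exponential, cf. `ineq179_of_factors`'s `cV` and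
`B16LargeFieldFactors380.vacuumLine380`), `C'` the O(1) of p. 383 l. 23 («exp O(1)|Z_j ∩ Ω_j|»), `M`,
`d`, `γ₀` («an absolute positive constant (in this factor we may take γ₀ = 1∕2)», p. 380), `A₀`∕`p₀` of `p₀(g) = A₀(log g⁻²)^{p₀}`
(`Setup.p0Profile`), `A₁`, `B₃` of the printed minimum `min{½B₃⁻²A₀², 2A₁², A₁²}` (`B16LargeFieldFactors380.minConst`), and TWO
PROFILES READ OFF THE RUN (owner ruling C-97-2 for the sibling: never a run-frozen step sequence): `R : ℝ → ℝ`, `R_j = R(g_j)`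
([Balaban1988Convergent] (2.5) p. 255), and `P1 : ℝ → ℝ`, `p₁(g_j) = P1(g_j)` ([Balaban1989LargeFieldI] p. 183 l. 1 ∕ (1.27): *"δ′_j =
g_jA₁p₁(g_j), p₁(g_j) = (log g_j⁻²)^{p₁}, and p₁ < p₀"*; tree letter `B15.Ineq194Flow.deltaPrimeK`).  Symbolic, never
valued; letters only; nothing claimed. [cite: Balaban1989LargeFieldII, pp.380-383 (the constants named there)] -/
structure Consts where
  (C380 C' M γ₀ A₀ A₁ B₃ : ℝ)
  (d p₀ : ℕ)
  /-- the profiles `R(g)` of (2.5) [III] and `p₁(g)` of [Balaban1989LargeFieldI] p. 183 l. 1 -/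
  (R P1 : ℝ → ℝ)

/-! ## §2 The per-step sentences at one step, and the printed claim for a construction -/

/-- **pp. 380–383's FACTOR SENTENCES FOR THE STEP `j → j + 1` OF THE RUN `D`, ON THE CARRIERS `X`** — the conjunction, each
threshold read off the run's flow AT PRINT's LEVEL FOR THAT OPERATION (refuter π-J3lit-1 ∕ repair (α′), journal l.47732; owner
D-J4-1): the regions the operation CREATES are level-`(j+1)` objects — (V) and (F) at `g_{j+1} = D.flow.g (j+1)` ((1.85)
pp. 385–386: «Σ_i(γ₀A₁²p₀²(g_{j+1})(d′_{j+1}(Z_{j+1}^{(i)}) + 1) + 2p₀(g_{j+1})) − O(1)M^dR_{j+1}^{d+1}d′_{j+1}(Z)»; p. 380 «characteristic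
functions introduced in the j^{th} step … χᶜ_j(P_j) … ε_j … R_j» for the step PRODUCING level j) —, the preparatory renewals
the same operation performs act on level-`j` components — (P) at `g_j = D.flow.g j` (p. 385 last ¶ – p. 386 l. 1–2: «take a component Z of
Z_{j+1} … Z = S(Z₀), Z₀ satisfies the conditions (i), (ii), and a new large field was introduced in the preparatory operations …
we have the new factor exp(−p₀(g_j))»; p. 381: «j is the index of the considered large field region satisfying (i), (ii)»):
(Y) *"yields the factor"* (p. 380 l. 12–18, p. 380 bottom – p. 381 top, pp. 381–383, p. 383 l. 21–24, read together for ONE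
step, before the history sum and before the product over steps of (1.79)): the unit weight of the choice is at most
`gInt · aInt · vfac · Π_{i ∈ comps} bfac · Π_{i ∈ primed} lfPrep`;
(V) p. 380 l. 12–18, FIRST printed form, for the created region (level `j+1`): *"every large field domain Z_j contributes the
constant O(1) log g_j⁻²|Z_j|"* — `vfac ≤ exp(C380 · log g_{j+1}⁻² · |Z_{j+1}|)`, `|Z_{j+1}| ≥ 0` (print's further chain «≦ O(1) log
g_j⁻²(MR_j)^d d′_j(Z_j) ≦ O(1)M^dR_j^{d+1}d′_j(Z_j)» is the sibling's `vacuumLine380` in the repaired `+1` reading and enters §3 as the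
hypothesis `hchain`, at level `j+1`);
(F) p. 381 top, left member, per created component (level `j+1`): `0 ≤ bfac ≤ exp(−γ₀ min{½B₃⁻²A₀², 2A₁², A₁²} p₀²(g_{j+1})
(d′_{j+1}(Z_{j+1}^{(i)}) + 1))`, with `d′ ≥ 0` (a linear size);
(P) p. 383 after (1.78), per primed level-`j` component renewed by the operation: `0 ≤ lfPrep ≤ exp(−R(g_j)^{−d−5} p₁²(g_j))`
(*"This is the largest factor among all the small factors we have obtained from the large field characteristic functions in
the preparatory steps"*);
(I) p. 383 l. 21–24: `0 ≤ gInt ≤ 1`, `0 ≤ aInt ≤ exp(C′|Z_j ∩ Ω_j|)`.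
A `Prop`; HYPOTHESIS SHAPE; nothing asserted; which choices ∕ unit weights are Bałaban's is the consumer's junction ((A1c)).
[cite: Balaban1989LargeFieldII, p.380 l.12-18, p.381 (before (1.76)), p.383 (after (1.78)), p.383 l.21-24, pp.385-386 with (1.85)] -/
def StepDisplaysAt (D : B16.RunData) (j : ℕ) (X : StepCarriers D j) (c : Consts) : Prop :=
  (∀ p v, X.T1 p v ≤
      X.gInt p * X.aInt p * X.vfac p * (∏ i ∈ X.comps p, X.bfac p i) * ∏ i ∈ X.primed p, X.lfPrep p i) ∧
  (∀ p, 0 ≤ X.volZ p ∧ X.vfac p ≤ Real.exp (c.C380 * Real.log ((D.flow.g (j + 1)) ^ 2)⁻¹ * X.volZ p)) ∧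
  (∀ p, ∀ i ∈ X.comps p, 0 ≤ X.dC p i ∧ 0 ≤ X.bfac p i ∧
      X.bfac p i ≤
        Real.exp (-(c.γ₀ * minConst c.B₃ c.A₀ c.A₁ * p0Profile c.A₀ c.p₀ (D.flow.g (j + 1)) ^ 2 * (X.dC p i + 1)))) ∧
  (∀ p, ∀ i ∈ X.primed p, 0 ≤ X.lfPrep p i ∧
      X.lfPrep p i ≤ Real.exp (-(c.R (D.flow.g j) ^ (c.d + 5))⁻¹ * c.P1 (D.flow.g j) ^ 2)) ∧
  (∀ p, 0 ≤ X.gInt p ∧ X.gInt p ≤ 1 ∧ 0 ≤ X.aInt p ∧ X.aInt p ≤ Real.exp (c.C' * X.volZΩ p))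

/-- **[Balaban1989LargeFieldII] pp. 380–383's PER-STEP FACTOR SENTENCES AS ONE PRINTED CLAIM FOR A CONSTRUCTION** (pattern
`B16.Thm1Printed` ∕ `Sect1DisplaysPrinted`).  p. 355 Theorem 1, verbatim: *"If the sequence of the effective coupling constants
is contained in an interval ]0, γ] with a sufficiently small positive γ, then the effective densities ρ_k have the form, and
satisfy all the conditions and bounds, described in Sect. 2 [III]."*; its proof bounds 𝐓′_k(X)1 (p. 380 l. 8–9) by walking
through the steps j = 1, …, k of (1.71) and recording, at EACH step, the factors of pp. 380–383 (*"Consider large field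
characteristic functions introduced in the j^{th} step"*), summarised afterwards as (1.79).  Typed: for the one-step carriers
`X P j` read off each run `P` at each of its steps `j < K` and the letters `c`, *there is γ > 0 such that for every run whose
effective couplings satisfy `0 < g_j ≤ γ` (j ≤ K) and every step `j < K`, `StepDisplaysAt` holds on `X P j`*.  HYPOTHESIS
SHAPE: consumed only as `(h : StepFactorsPrinted C X c)`; never proved here, never asserted; the NAME under which the cell's
per-step display `hw` (IR-99-3) cites print once J3 identifies the tower's one-step maps with (1.71)'s.  INDEX CONVENTION
(refuter π-J3lit-1, repair (α′); owner D-J4-1): step `j < K` here = the cell's tower step `op j` (level `j` → `j + 1`); the births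
(F) and the volume line (V) of the regions it creates are read at `g_{j+1}` (print's step producing level `j+1`; (1.85)), the
preparatory renewals (P) it performs on level-`j` components at `g_j` (p. 385 last ¶ – p. 386 l. 1–2) — so `j < K` covers the births of EVERY level
`1, …, K` of 𝐓′_K and the renewals of every operation, and the cell's pinned display (IR-100-1 (A): `fBexp sB K (j+1)`,
`Λexp … K (j+1)`, `fRexp sR K j`) reads each kind at the same index with no flow comparison.  (1.79) p. 383 files the same factors BY
LEVEL (its level-j factor = Π_i over Z_j's components × Π′ over Z_j's primed components, both at `g_j`): §3's `stepFactor179_le`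
delivers `hfac`'s level-(j+1) volume·Π_i slots and its level-j Π′ slot.
[cite: Balaban1989LargeFieldII, Thm 1 p.355 with pp.380-383 (before (1.79))] -/
def StepFactorsPrinted (C : B16.Construction) (X : (P : B12.RunParams) → (j : ℕ) → StepCarriers (C P) j) (c : Consts) :
    Prop :=
  ∃ γ : ℝ, 0 < γ ∧ ∀ P : B12.RunParams, (C P).flow.InInterval γ P.K → ∀ j, j < P.K → StepDisplaysAt (C P) j (X P j) c

/-! ## §3 Bookkeeping: what a consumer cites (by `And`-elimination), and the PROVED junction with (1.79)'s per-step factor -/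

section Proj

variable {D : B16.RunData} {j : ℕ} {X : StepCarriers D j} {c : Consts}

/-- Under the step's sentences: the «yields» inequality (Y), by `And`-elimination (nothing beyond the hypothesis).
[cite: Balaban1989LargeFieldII, pp.380-383 (before (1.79))] -/
theorem yields_of (h : StepDisplaysAt D j X c) (p : X.Choice) (v : X.V) :
    X.T1 p v ≤ X.gInt p * X.aInt p * X.vfac p * (∏ i ∈ X.comps p, X.bfac p i) * ∏ i ∈ X.primed p, X.lfPrep p i :=
  h.1 p v

/-- Under the step's sentences: the volume constant of the created region in its first printed form (V) — *"every large field
domain Z_j contributes the constant O(1) log g_j⁻²|Z_j|"* (at the created level `j+1`) —, by `And`-elimination. [cite: Balaban1989LargeFieldII, p.380 l.12-18] -/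
theorem vfac_le_of (h : StepDisplaysAt D j X c) (p : X.Choice) :
    X.vfac p ≤ Real.exp (c.C380 * Real.log ((D.flow.g (j + 1)) ^ 2)⁻¹ * X.volZ p) :=
  (h.2.1 p).2

/-- Under the step's sentences: the fundamental large-field factor of a created component (level `j+1`, read at `g_{j+1}`) in the
SHARP printed `min{…}` form (F) — p. 381 top, left member —, by `And`-elimination. [cite: Balaban1989LargeFieldII, p.381 (before (1.76))] -/
theorem bfac_le_of (h : StepDisplaysAt D j X c) (p : X.Choice) {i : X.ι} (hi : i ∈ X.comps p) :
    X.bfac p i ≤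
      Real.exp (-(c.γ₀ * minConst c.B₃ c.A₀ c.A₁ * p0Profile c.A₀ c.p₀ (D.flow.g (j + 1)) ^ 2 * (X.dC p i + 1))) :=
  (h.2.2.1 p i hi).2.2

/-- Under the step's sentences: a preparatory factor is at most the largest one, `exp(−R_j^{−d−5}p₁²(g_j))` (P), by
`And`-elimination. [cite: Balaban1989LargeFieldII, p.383 (after (1.78))] -/
theorem lfPrep_le_of (h : StepDisplaysAt D j X c) (p : X.Choice) {i : X.ι} (hi : i ∈ X.primed p) :
    X.lfPrep p i ≤ Real.exp (-(c.R (D.flow.g j) ^ (c.d + 5))⁻¹ * c.P1 (D.flow.g j) ^ 2) :=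
  (h.2.2.2.1 p i hi).2

/-- **THE JUNCTION WITH (1.79)'s PER-STEP FACTOR, PROVED** (real arithmetic over the abstract carriers; every silent input an
explicit hypothesis, exactly those of the siblings): under the step's sentences, p. 380's chain for the volume constant read for
the carrier `dZ` at the created level (`hchain : C380·log g_{j+1}⁻²·|Z_{j+1}| ≦ cV·M^d·R(g_{j+1})^{d+1}·dZ` — the sibling's
`vacuumLine380` in the repaired `+1` reading, a HYPOTHESIS here as `habsA`∕`habsE` are in `ineq179_of_factors`), the constants-ledger
relation `2B₃²A₁² ≦ A₀²` and the smallness `4 ≦ γ₀A₁²p₀(g_{j+1})` of `B16LargeFieldFactors380.display381` (p. 381's «≦»), and the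
rounding *"we estimate the factors by exp(−p₀(g_j))"* of p. 383 supplied as `hround` (dischargeable by
`B16Sect1Kernels.exp_lfFactor_le_exp_neg_p0` under the proviso `2p₁ − (d + 5)r₀ > p₀` in the normalisation `A₀ = 1` of that file's
`ℓ = log g_j⁻²` dictionary — `Setup.p0Profile` carries `A₀`, so for `A₀ ≠ 1` an `A₀`-aware variant is wanted; `hround` stays a displayed
hypothesis either way — chair X-IR1002 note N-1), the unit weight of the choice is at most
`gInt · aInt · exp(cV·M^d·R_{j+1}^{d+1}·dZ) · Π_i exp(−½γ₀A₁²p₀²(g_{j+1})(d′ + 1) − 2p₀(g_{j+1})) · Π′ exp(−p₀(g_j))` — LETTER FOR LETTER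
the level-(j+1) volume·Π_i slots and the level-j Π′ slot of the hypothesis `hfac` of `B16Ineq179.ineq179_of_factors` (at
`R ℓ := R(g_ℓ)`, `p0 ℓ := p₀(g_ℓ)`), whose product over the operations of an admissible history re-associates BY LEVEL into (1.79)'s
`Π_{j=1}^{k}` (the consumer's regrouping, J4) and whose sum over histories print summarises as (1.79).  Nothing of Bałaban's
asserted: an implication between hypothesis shapes.
[cite: Balaban1989LargeFieldII, p.383 («Let us summarize now the results of the above estimates»)] -/
theorem stepFactor179_le (h : StepDisplaysAt D j X c) {cV : ℝ} (p : X.Choice)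
    (hchain : c.C380 * Real.log ((D.flow.g (j + 1)) ^ 2)⁻¹ * X.volZ p ≤
      cV * c.M ^ c.d * c.R (D.flow.g (j + 1)) ^ (c.d + 1) * X.dZ p)
    (hB₃ : c.B₃ ≠ 0) (hγ : 0 ≤ c.γ₀)
    (hp : 0 ≤ p0Profile c.A₀ c.p₀ (D.flow.g (j + 1))) (hR2 : 2 * c.B₃ ^ 2 * c.A₁ ^ 2 ≤ c.A₀ ^ 2)
    (hsmall : 4 ≤ c.γ₀ * c.A₁ ^ 2 * p0Profile c.A₀ c.p₀ (D.flow.g (j + 1)))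
    (hround : Real.exp (-(c.R (D.flow.g j) ^ (c.d + 5))⁻¹ * c.P1 (D.flow.g j) ^ 2) ≤
      Real.exp (-p0Profile c.A₀ c.p₀ (D.flow.g j)))
    (v : X.V) :
    X.T1 p v ≤
      X.gInt p * X.aInt p * Real.exp (cV * c.M ^ c.d * c.R (D.flow.g (j + 1)) ^ (c.d + 1) * X.dZ p) *
        ((∏ i ∈ X.comps p,
            Real.exp (-(1 / 2) * c.γ₀ * c.A₁ ^ 2 * p0Profile c.A₀ c.p₀ (D.flow.g (j + 1)) ^ 2 * (X.dC p i + 1) -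
              2 * p0Profile c.A₀ c.p₀ (D.flow.g (j + 1)))) *
          ∏ _i ∈ X.primed p, Real.exp (-p0Profile c.A₀ c.p₀ (D.flow.g j))) := by
  obtain ⟨hY, hV, hF, hP, hI⟩ := h
  set g' := D.flow.g (j + 1) with hg'
  set g := D.flow.g j with hg
  set q := p0Profile c.A₀ c.p₀ g' with hq
  set q₀ := p0Profile c.A₀ c.p₀ g with hq₀
  -- per component: the sharp `min{…}` factor, then p. 381's display
  have hcomp : ∀ i ∈ X.comps p, X.bfac p i ≤
      Real.exp (-(1 / 2) * c.γ₀ * c.A₁ ^ 2 * q ^ 2 * (X.dC p i + 1) - 2 * q) := fun i hi => by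
    obtain ⟨hd, -, hle⟩ := hF p i hi
    refine hle.trans ((display381 hB₃ hγ hp hd hR2 hsmall).trans (le_of_eq ?_))
    congr 1
    ring
  -- per primed component: the largest preparatory factor, then the rounding of p. 383
  have hprep : ∀ i ∈ X.primed p, X.lfPrep p i ≤ Real.exp (-q₀) := fun i hi => (hP p i hi).2.trans hround
  have hL0 : 0 ≤ ∏ i ∈ X.primed p, X.lfPrep p i := Finset.prod_nonneg fun i hi => (hP p i hi).1
  have hB : ∏ i ∈ X.comps p, X.bfac p i ≤
      ∏ i ∈ X.comps p, Real.exp (-(1 / 2) * c.γ₀ * c.A₁ ^ 2 * q ^ 2 * (X.dC p i + 1) - 2 * q) :=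
    Finset.prod_le_prod (fun i hi => (hF p i hi).2.1) hcomp
  have hL : ∏ i ∈ X.primed p, X.lfPrep p i ≤ ∏ _i ∈ X.primed p, Real.exp (-q₀) :=
    Finset.prod_le_prod (fun i hi => (hP p i hi).1) hprep
  -- the volume constant: first printed form, then p. 380's chain read for `dZ`
  have hvf : X.vfac p ≤ Real.exp (cV * c.M ^ c.d * c.R g' ^ (c.d + 1) * X.dZ p) :=
    (hV p).2.trans (Real.exp_le_exp.mpr hchain)
  have hGA0 : 0 ≤ X.gInt p * X.aInt p := mul_nonneg (hI p).1 (hI p).2.2.1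
  have hA0 : 0 ≤ X.gInt p * X.aInt p * Real.exp (cV * c.M ^ c.d * c.R g' ^ (c.d + 1) * X.dZ p) :=
    mul_nonneg hGA0 (Real.exp_pos _).le
  have hB0 : 0 ≤ ∏ i ∈ X.comps p, X.bfac p i := Finset.prod_nonneg fun i hi => (hF p i hi).2.1
  have hE0 : 0 ≤ ∏ i ∈ X.comps p, Real.exp (-(1 / 2) * c.γ₀ * c.A₁ ^ 2 * q ^ 2 * (X.dC p i + 1) - 2 * q) :=
    Finset.prod_nonneg fun _ _ => (Real.exp_pos _).le
  calc X.T1 p v ≤ X.gInt p * X.aInt p * X.vfac p * (∏ i ∈ X.comps p, X.bfac p i) * ∏ i ∈ X.primed p, X.lfPrep p i :=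
        hY p v
    _ ≤ X.gInt p * X.aInt p * Real.exp (cV * c.M ^ c.d * c.R g' ^ (c.d + 1) * X.dZ p) *
        (∏ i ∈ X.comps p, X.bfac p i) * ∏ i ∈ X.primed p, X.lfPrep p i :=
      mul_le_mul_of_nonneg_right (mul_le_mul_of_nonneg_right (mul_le_mul_of_nonneg_left hvf hGA0) hB0) hL0
    _ ≤ X.gInt p * X.aInt p * Real.exp (cV * c.M ^ c.d * c.R g' ^ (c.d + 1) * X.dZ p) *
        (∏ i ∈ X.comps p, Real.exp (-(1 / 2) * c.γ₀ * c.A₁ ^ 2 * q ^ 2 * (X.dC p i + 1) - 2 * q)) *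
          ∏ _i ∈ X.primed p, Real.exp (-q₀) :=
      mul_le_mul (mul_le_mul_of_nonneg_left hB hA0) hL hL0 (mul_nonneg hA0 hE0)
    _ = _ := by ring

/-- **THE ROOM OF p. 381's LEFT MEMBER OVER ITS RIGHT MEMBER, PROVED** (real arithmetic; the located answer to the row
OWNER's question Q-J3-2 ∕ finding F-ne7bp1-g100-1, journal l.47579, «is a strictly sharper printed birth factor per event
DISPLAYED?» — YES: p. 381 l. 1–2 displays BOTH members, *"exp(−γ₀ min{½B₃⁻²A₀², 2A₁², A₁²}p₀²(g_j)(d′_j(Z_j^{(i)}) + 1)) ≦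
exp(−½γ₀A₁²p₀²(g_j)(d′_j(Z_j^{(i)}) + 1) − 2p₀(g_j))"*, render p027 READ AS AN IMAGE; the LEFT member is the SHARP valuation
(F) pins, the RIGHT member is (1.79)'s face value = the count road's booked birth credit).  Under the inputs of the sibling's
`display381` — the constants-ledger relation `2B₃²A₁² ≦ A₀²` (so `min{…} = A₁²`, `min_eq_A1sq`) and `4 ≦ γ₀A₁²p₀(g_j)` — the
exponent ROOM `γ₀·min{…}·p₀²(d′+1) − (½γ₀A₁²p₀²(d′+1) + 2p₀)` is at least `½γ₀A₁²p₀²(g_j)·d′` (in particular `≥ 0`, and of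
order `p₀(g_j)²` per unit of linear size).  Nothing of Bałaban's asserted. [cite: Balaban1989LargeFieldII, p.381 (before (1.76))] -/
theorem birthRoom381 {γ₀ B₃ A₀ A₁ p₀g : ℝ} (d' : ℝ) (hB₃ : B₃ ≠ 0) (hp : 0 ≤ p₀g)
    (hR2 : 2 * B₃ ^ 2 * A₁ ^ 2 ≤ A₀ ^ 2) (hsmall : 4 ≤ γ₀ * A₁ ^ 2 * p₀g) :
    1 / 2 * γ₀ * A₁ ^ 2 * p₀g ^ 2 * d' ≤
      γ₀ * minConst B₃ A₀ A₁ * p₀g ^ 2 * (d' + 1) - (1 / 2 * γ₀ * A₁ ^ 2 * p₀g ^ 2 * (d' + 1) + 2 * p₀g) := by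
  rw [min_eq_A1sq hB₃ hR2]
  have h1 : 4 * p₀g ≤ γ₀ * A₁ ^ 2 * p₀g * p₀g := mul_le_mul_of_nonneg_right hsmall hp
  nlinarith [h1]

/-- The same room is non-negative (drop the `d′`-term: `0 ≤ ½γ₀A₁²p₀²·d′` since `4 ≦ γ₀A₁²p₀(g_j)` forces `0 ≤ γ₀A₁²`), i.e. the
sharp p. 381-LEFT birth valuation dominates the face value — the exponent form of `display381`. [cite: Balaban1989LargeFieldII, p.381 (before (1.76))] -/
theorem birthRoom381_nonneg {γ₀ B₃ A₀ A₁ p₀g d' : ℝ} (hB₃ : B₃ ≠ 0) (hp : 0 ≤ p₀g) (hd' : 0 ≤ d')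
    (hR2 : 2 * B₃ ^ 2 * A₁ ^ 2 ≤ A₀ ^ 2) (hsmall : 4 ≤ γ₀ * A₁ ^ 2 * p₀g) :
    0 ≤ γ₀ * minConst B₃ A₀ A₁ * p₀g ^ 2 * (d' + 1) - (1 / 2 * γ₀ * A₁ ^ 2 * p₀g ^ 2 * (d' + 1) + 2 * p₀g) := by
  have h := birthRoom381 d' hB₃ hp hR2 hsmall
  have hγA : 0 ≤ γ₀ * A₁ ^ 2 := by
    by_contra hneg
    have : γ₀ * A₁ ^ 2 * p₀g ≤ 0 := mul_nonpos_of_nonpos_of_nonneg (not_le.mp hneg).le hp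
    linarith
  have h0 : 0 ≤ 1 / 2 * γ₀ * A₁ ^ 2 * p₀g ^ 2 * d' := by
    have : 0 ≤ 1 / 2 * (γ₀ * A₁ ^ 2) * p₀g ^ 2 * d' := by positivity
    linarith [this]
  linarith

end Proj

section Printed

variable {C : B16.Construction} {X : (P : B12.RunParams) → (j : ℕ) → StepCarriers (C P) j} {c : Consts}

/-- Under the printed claim, at a run in the window and a step `j < K`: the step's sentences hold on the run's one-step
carriers — by `∃`∕`∀`-elimination (nothing beyond the hypothesis). [cite: Balaban1989LargeFieldII, pp.380-383 (before (1.79))] -/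
theorem stepDisplaysAt_of (h : StepFactorsPrinted C X c) :
    ∃ γ : ℝ, 0 < γ ∧ ∀ P : B12.RunParams, (C P).flow.InInterval γ P.K → ∀ j, j < P.K →
      StepDisplaysAt (C P) j (X P j) c :=
  h

/-- Under the printed claim: the «yields» inequality (Y) at every step of every run in the window.
[cite: Balaban1989LargeFieldII, pp.380-383 (before (1.79))] -/
theorem yields_of_printed (h : StepFactorsPrinted C X c) :
    ∃ γ : ℝ, 0 < γ ∧ ∀ P : B12.RunParams, (C P).flow.InInterval γ P.K → ∀ j, j < P.K → ∀ p v,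
      (X P j).T1 p v ≤
        (X P j).gInt p * (X P j).aInt p * (X P j).vfac p *
          (∏ i ∈ (X P j).comps p, (X P j).bfac p i) * ∏ i ∈ (X P j).primed p, (X P j).lfPrep p i := by
  obtain ⟨γ, hγ, hall⟩ := h
  exact ⟨γ, hγ, fun P hP j hj p v => yields_of (hall P hP j hj) p v⟩

end Printed

/-! ## §4 Sanity: the SHAPE is inhabited by trivial carriers (non-vacuity of the shape; says NOTHING about Bałaban's objects
— the «vacuous in isolation» caveat of memo g62 §3, as for (A1b)) -/

/-- SANITY (shape non-vacuity only): one choice with no component, unit weight `≡ 1`, integrals `≡ 1`, `d′_j(Z_j) = 0`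
(volume constant `1`, `|Z_j| = 0`) satisfies `StepDisplaysAt` (empty products, `exp 0 = 1`). [folklore] -/
example (D : B16.RunData) (j : ℕ) (c : Consts) :
    StepDisplaysAt D j
      { Choice := Unit, V := Unit, ι := Unit, T1 := fun _ _ => 1, comps := fun _ => ∅, primed := fun _ => ∅,
        dC := fun _ _ => 0, bfac := fun _ _ => 0, lfPrep := fun _ _ => 0, vfac := fun _ => 1, volZ := fun _ => 0,
        dZ := fun _ => 0, gInt := fun _ => 1, aInt := fun _ => 1, volZΩ := fun _ => 0 } c := by
  refine ⟨fun p v => ?_, fun p => ?_, fun p i hi => ?_, fun p i hi => ?_, fun p => ?_⟩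
  · simp
  · simp
  · simp at hi
  · simp at hi
  · simp

/-- SANITY (shape non-vacuity of the PRINTED-CLAIM pattern; says NOTHING about Bałaban's construction): for ANY construction,
the trivial one-step carriers above inhabit `StepFactorsPrinted` with `γ := 1` — the «vacuous in isolation» caveat made
kernel-explicit: the claim constrains a construction only through the carriers a consumer reads off it. [folklore] -/
example (C : B16.Construction) (c : Consts) :
    StepFactorsPrinted C
      (fun _ _ =>
        { Choice := Unit, V := Unit, ι := Unit, T1 := fun _ _ => 1, comps := fun _ => ∅, primed := fun _ => ∅,
          dC := fun _ _ => 0, bfac := fun _ _ => 0, lfPrep := fun _ _ => 0, vfac := fun _ => 1, volZ := fun _ => 0,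
          dZ := fun _ => 0, gInt := fun _ => 1, aInt := fun _ => 1, volZΩ := fun _ => 0 }) c := by
  refine ⟨1, one_pos, fun P _ j _ => ?_⟩
  refine ⟨fun p v => ?_, fun p => ?_, fun p i hi => ?_, fun p i hi => ?_, fun p => ?_⟩
  · simp
  · simp
  · simp at hi
  · simp at hi
  · simp

end

end Literature.MathematicalPhysics.QuantumFieldTheory.Balaban1983to89.B16StepFactorsPrinted
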